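import Summits.Ventures.PackingBounds.Configurations.OddFamily

/-!
# The `(2n+1)`-point family: the root `mₙ` of `Gₙ` in `(0, 1/n)` is unique

Framing: lottery ticket; floor = certified bounds/negative ranges. Venture `PackingBounds` (cell `pub-packcert`,
seat `pub-packcert-recog`, T5-ATTAINED (ii) (A)).  Complement to `OddFamily.lean` (referee audit L677 noted that
root uniqueness was not part of the landed theorem): `Gₙ(x) = n²(n−2)² x⁴ − 4n(n−1) x³ − 2n² x² + 1` is STRICTLY
DECREASING on `[0, 1/n]` for `n ≥ 2` (`quartic_strictAntiOn`; elementary: `Gₙ(y) − Gₙ(x) = (y − x)·Bₙ(x,y)` with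
`Bₙ < 0` there because `n²x², n²y² ≤ 1`), hence it has exactly one root in `(0, 1/n)` (`existsUnique_root`), and
that root is the `m` of `OddFamily.exists_code_card_two_mul_add_one`: `A(n, arccos mₙ) ≥ 2n + 1` for THE root `mₙ`.
Pure proofs; no new definitions.
-/

namespace Summit.Ventures.PackingBounds.Config.OddFamily

/-- Difference formula `Gₙ(y) − Gₙ(x) = (y − x) · Bₙ(x, y)`. -/
theorem quartic_sub_quartic (n : ℕ) (x y : ℝ) :
    quartic n y - quartic n x = (y - x) *
      ((n : ℝ) ^ 2 * ((n : ℝ) - 2) ^ 2 * (y ^ 3 + y ^ 2 * x + y * x ^ 2 + x ^ 3)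
        - 4 * (n : ℝ) * ((n : ℝ) - 1) * (y ^ 2 + y * x + x ^ 2) - 2 * (n : ℝ) ^ 2 * (y + x)) := by
  unfold quartic
  ring

/-- **`Gₙ` is strictly decreasing on `[0, 1/n]`** (`n ≥ 2`): for `0 ≤ x < y ≤ 1/n` the factor `Bₙ(x, y)` is
negative, since `n²(x² + y²) ≤ 2` gives `n²(n−2)²(x+y)(x²+y²) ≤ 2(n−2)²(x+y) < 2n²(x+y)`. -/
theorem quartic_strictAntiOn (n : ℕ) (hn : 2 ≤ n) :
    StrictAntiOn (quartic n) (Set.Icc 0 (1 / (n : ℝ))) := by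
  intro x hx y hy hxy
  have hN : (2 : ℝ) ≤ n := by exact_mod_cast hn
  have hN0 : (0 : ℝ) < n := by linarith
  obtain ⟨⟨hx0, hx1⟩, ⟨hy0, hy1⟩⟩ := And.intro hx hy
  obtain ⟨hx1', hy1'⟩ : (n : ℝ) * x ≤ 1 ∧ (n : ℝ) * y ≤ 1 :=
    ⟨by rwa [le_div_iff₀ hN0, mul_comm] at hx1, by rwa [le_div_iff₀ hN0, mul_comm] at hy1⟩
  have h1 : (n : ℝ) ^ 2 * x ^ 2 ≤ 1 := by nlinarith [mul_nonneg (mul_nonneg hN0.le hx0) (sub_nonneg.2 hx1')]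
  have h2 : (n : ℝ) ^ 2 * y ^ 2 ≤ 1 := by nlinarith [mul_nonneg (mul_nonneg hN0.le hy0) (sub_nonneg.2 hy1')]
  have h4 : 0 < y + x := by linarith
  have h3 : ((n : ℝ) - 2) ^ 2 * (y + x) * ((n : ℝ) ^ 2 * x ^ 2 + (n : ℝ) ^ 2 * y ^ 2)
      ≤ ((n : ℝ) - 2) ^ 2 * (y + x) * 2 :=
    mul_le_mul_of_nonneg_left (by linarith) (mul_nonneg (sq_nonneg _) h4.le)
  have h5 : 0 ≤ 4 * (n : ℝ) * ((n : ℝ) - 1) * (y ^ 2 + y * x + x ^ 2) :=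
    mul_nonneg (mul_nonneg (by positivity) (by linarith)) (by positivity)
  have h6 : 0 < (y + x) * (8 * (n : ℝ) - 8) := mul_pos h4 (by linarith)
  have e : (n : ℝ) ^ 2 * ((n : ℝ) - 2) ^ 2 * (y ^ 3 + y ^ 2 * x + y * x ^ 2 + x ^ 3)
      = ((n : ℝ) - 2) ^ 2 * (y + x) * ((n : ℝ) ^ 2 * x ^ 2 + (n : ℝ) ^ 2 * y ^ 2) := by ring
  have hB : (n : ℝ) ^ 2 * ((n : ℝ) - 2) ^ 2 * (y ^ 3 + y ^ 2 * x + y * x ^ 2 + x ^ 3)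
      - 4 * (n : ℝ) * ((n : ℝ) - 1) * (y ^ 2 + y * x + x ^ 2) - 2 * (n : ℝ) ^ 2 * (y + x) < 0 := by
    rw [e]; nlinarith [h3, h5, h6]
  nlinarith [mul_pos (sub_pos.2 hxy) (neg_pos.2 hB), quartic_sub_quartic n x y]

/-- **The root is unique**: two roots of `Gₙ` in `[0, 1/n]` coincide (`n ≥ 2`). -/
theorem quartic_root_unique (n : ℕ) (hn : 2 ≤ n) {m m' : ℝ} (hm : m ∈ Set.Icc 0 (1 / (n : ℝ)))
    (hm' : m' ∈ Set.Icc 0 (1 / (n : ℝ))) (h : quartic n m = 0) (h' : quartic n m' = 0) : m = m' :=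
  (quartic_strictAntiOn n hn).injOn hm hm' (h.trans h'.symm)

/-- **`mₙ` is well defined**: `Gₙ` has exactly one root in `(0, 1/n)` (`n ≥ 2`); by `quartic_root_unique` it is
the `m` of `exists_code_card_two_mul_add_one`, i.e. `A(n, arccos mₙ) ≥ 2n + 1` for THE root `mₙ`. -/
theorem existsUnique_root (n : ℕ) (hn : 2 ≤ n) :
    ∃! m : ℝ, (0 < m ∧ m < 1 / (n : ℝ)) ∧ quartic n m = 0 := by
  obtain ⟨m, hm0, hm1, hq, -⟩ := exists_code_card_two_mul_add_one n hn
  refine ⟨m, ⟨⟨hm0, hm1⟩, hq⟩, fun m' hm' => ?_⟩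
  exact quartic_root_unique n hn ⟨hm'.1.1.le, hm'.1.2.le⟩ ⟨hm0.le, hm1.le⟩ hm'.2 hq

end Summit.Ventures.PackingBounds.Config.OddFamily
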